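import Summits.HodgeConjecture.HodgeConjecture.Theorems.MarkmanPartnerTransportK3Sq2KugaSatakeSelfPresentationHK
import Literature.AlgebraicGeometry.Motives.HodgeStructureQuotient

/-!
# Route MarkmanPartnerTransport · crux `LowPicardRealMultiplication` (stmt-HodgeConjecture-19653) —
# programme «KS-SELF-X», step 3: Hodge endomorphisms preserve the transcendental part; algebraic
# self-correspondences of a marked `K3^{[2]}`-type fourfold descend to `End_Hdg(T(X)_ℚ)`; positivity of the
# multiplier

The `K3^{[2]}`-side twin of gen 14's `…KugaSatakeSelfDescent` §1–2 and §4. On a SURFACE an algebraic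
self-correspondence preserves `T(S)_ℂ = N¹(S)^⊥` by adjunction with its (algebraic) transpose for the cup
product. On the fourfold `X` the transcendental part is the orthogonal of `N¹(X)` for the Beauville–Bogomolov
form, for which no such adjunction is available; instead we use the HODGE-THEORETIC invariance:

* §1 `apply_mem_of_isTranscendentalPart_of_irreducible` — for ANY weight-two `ℚ`-Hodge structure `H`, a
  transcendental part `T` (`IsTranscendentalPart`: `V^{2,0} ⊆ T_ℂ`, `T` minimal) which is irreducible with
  `T^{2,0} ≠ 0`, and ANY morphism `Φ : H → H` of Hodge structures: `Φ(T) ⊆ T`. Proof: the composite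
  `f : T → H → H/T` is a morphism of Hodge structures; its kernel is a sub-Hodge structure of the irreducible `T`
  (`Hom.ker`), hence `0` or `T`; if `0`, `f_ℂ` is injective (`Hom.baseChange_injective`) and maps `T^{2,0} ≠ 0`
  into `(H/T)^{2,0} = π_ℂ(V^{2,0}) = 0` (`quotient_piece_eq_map`, `V^{2,0} ⊆ T_ℂ`) — absurd; so `f = 0`.
* §2 the marked fourfold: `bbfTransc_of_twoZero` (a `(2,0)`-class is `q`-orthogonal to `N¹(X)`, clause (m5)),
  `mem_toSubmodule_iff_of_isTranscendentalPartHK` (the presentation's image clause in `q`-form),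
  `exists_baseChange_eq_of_bbfTransc` (`{y | y ⊥_q N¹(X)} = Θ(T_ℚ ⊗ ℂ)`), `apply_conjClassHK`,
  `isOfHodgeType_two_zero_of_isAlgebraicCorrespondenceHK`;
* §3 `exists_endAlg_of_isAlgebraicCorrespondenceHK` — an algebraic self-correspondence of `X` of degree `0` on
  `H²` which is RATIONAL (`[γ]_*`, `γ` a rational algebraic class) descends to `a ∈ End_Hdg(T(X)_ℚ)` with
  `[γ]_*(t ⊗ 1) = a(t) ⊗ 1` (§1 applied to its Hodge descent `exists_hom_ofRatClass_eqHK`);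
* §4 `multiplier_posHK` — a rational, type-preserving, `q`-self-adjoint `θ` with `θ(θσ) = dσ`, `d ≠ 0`, on the
  period class has `d > 0` (`θσ = λσ`, `λ q(z, z̄) = λ̄ q(z, z̄)`, `q(z, z̄) > 0` by (m6)).

THEOREMS ONLY; no definition, no new named fact, no sorry; nothing here says HC, the crux or Kuga–Satake is
proved. Prover seat hodge-nonav-19652-p1 (gen 15), `--supports stmt-HodgeConjecture-19653`.

References: C. Voisin, *Hodge Theory I* §7.3.1 (Lemma 7.25, Cor. 7.24), Lemma 11.41; D. Huybrechts, *Lectures on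
K3 Surfaces* Ch. 3 Lemma 3.1, §3.3; M. Varesco, Math. Z. 305 (2023) §4; B. van Geemen, *Kuga–Satake varieties
and the Hodge conjecture* (2000) §10.
-/

set_option linter.dupNamespace false

noncomputable section

namespace Summit.HodgeConjecture.HodgeConjecture.Theorems.MarkmanPartnerTransport.KugaSatakeHK

open scoped TensorProduct
open CategoryTheory MonoidalCategory Literature.AlgebraicGeometry Literature.AlgebraicGeometry.Motives
open Summit.HodgeConjecture.HodgeConjecture.Ring2.AbelianAll
open Literature.AlgebraicGeometry.HodgeTheory Literature.AlgebraicTopology.SingularHomology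
open Literature.AlgebraicGeometry.Motives.HodgeStructure Literature.AlgebraicGeometry.Hyperkaehler
open Literature.AlgebraicGeometry.Surfaces
open Summit.HodgeConjecture.HodgeConjecture.Theorems.NikulinTwinTransport
open Summit.HodgeConjecture.HodgeConjecture.Theorems.MarkmanPartnerTransport.BBFPositivity
open Summit.HodgeConjecture.HodgeConjecture.Theorems.MarkmanPartnerTransport.PartnerLattice
open Summit.HodgeConjecture.HodgeConjecture.Theorems.MarkmanPartnerTransport.KugaSatakeSelf

variable {X : SchemeOver ℂ} {φ : complexBetti X 2 ≃ₗ[ℂ] (K3HilbertIndex → ℂ)} {P : complexBetti X (2 * 4)}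
  {z : K3HilbertIndex → ℂ}

/-- `MarkedK3Sq[X, φ, P, z]`: VERBATIM the `let MarkedK3Sq := …` binder of the route declarations of
MarkmanPartnerTransport (clauses (m1)–(m6)). Local notation only. -/
local notation3 (prettyPrint := false) "MarkedK3Sq[" X ", " φ ", " P ", " z "]" =>
  (((IsIntegralClass P ∧ ∀ Q : complexBetti X (2 * 4), IsIntegralClass Q → ∃ n : ℤ, Q = n • P) ∧
    (∀ c : complexBetti X 2, IsIntegralClass c ↔ ∃ v : K3HilbertIndex → ℤ, φ c = fun i => (v i : ℂ)) ∧
    (∀ a : complexBetti X 2, cupPowTwo a 4 = ((3 : ℂ) * (k3HilbertForm 2 (φ a) (φ a)) ^ 2) • P) ∧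
    (IsOfHodgeType 4 X 2 2 0 (LinearEquiv.symm φ z) ∧
      ∀ τ : complexBetti X 2, IsOfHodgeType 4 X 2 2 0 τ → ∃ t : ℂ, τ = t • LinearEquiv.symm φ z) ∧
    (∀ c : complexBetti X 2, IsOfHodgeType 4 X 2 1 1 c ↔
      (k3HilbertForm 2 (φ c) z = 0 ∧ k3HilbertForm 2 (φ c) (star z) = 0)) ∧
    (k3HilbertForm 2 z z = 0 ∧ 0 < (k3HilbertForm 2 (star z) z).re)))

/-- `H²_B[hX]`: the weight-two `ℚ`-Hodge structure on `H²(X(ℂ); ℚ)` of the real Hodge model of the fourfold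
`X` (`hX : IsSmoothProjective (2 * 2) X`). Local notation only. -/
local notation3 "H²_B[" hX "]" =>
  bettiTwoHodgeStructureOfModel hX (BettiUniverse.realHodgeModel exists_isReal_hodgeModel_holds hX)
    (BettiUniverse.realHodgeModel_isHodgeSymmetric exists_isReal_hodgeModel_holds hX)

/-- `Θ : ℂ ⊗_ℚ H²(X(ℂ); ℚ) → H²(X(ℂ); ℂ)`. -/
local notation3 "Θ[" X "]" => ofRatClassBaseChange (Motives.ComplexPoints X) (2 * 1)

/-- `ι : H²(X(ℂ); ℚ) → H²(X(ℂ); ℂ)`, the rational lattice. -/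
local notation3 "ι[" X "]" => ofRatClass (Motives.ComplexPoints X) (2 * 1)


/-! ### §1 Morphisms of Hodge structures preserve an irreducible transcendental part -/

/-- **A morphism of weight-two Hodge structures maps the transcendental part into itself.** Let `T ⊆ H` be a
transcendental part (`V^{2,0} ⊆ T_ℂ`, `T` minimal with this property) which is irreducible with `T^{2,0} ≠ 0`,
and `Φ : H → H` a morphism of `ℚ`-Hodge structures. Then `Φ(T) ⊆ T`: the kernel of `T → H → H/T` is a sub-Hodge
structure of `T` (Voisin I, Lemma 7.25), so it is `0` or `T`; in the first case the complexified map is injective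
and carries `T^{2,0} ≠ 0` into `(H/T)^{2,0} = π_ℂ(V^{2,0}) = 0` — impossible. [cite: VoisinHodgeI2002, §7.3.1 Lemma 7.25]
[cite: Huybrechts2016K3, Ch. 3 §3.3 (Lemma 3.3.1)] -/
theorem apply_mem_of_isTranscendentalPart_of_irreducible {V : Type*} [AddCommGroup V] [Module ℚ V]
    {H : HodgeStructure V 2} {T : SubHodgeStructure H} (htr : H.IsTranscendentalPart T)
    (hirr : T.toHodgeStructure.IsIrreducible) (h20 : T.toHodgeStructure.piece 2 0 ≠ ⊥) (Φ : Hom H H)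
    {t : V} (ht : t ∈ T.toSubmodule) : Φ.toLinearMap t ∈ T.toSubmodule := by
  set f : Hom T.toHodgeStructure (H.quotient T) := T.mkQHom.comp (Φ.comp T.subtypeHom) with hf
  have hft : ∀ s : T.toSubmodule, f.toLinearMap s = T.toSubmodule.mkQ (Φ.toLinearMap (s : V)) := fun s => rfl
  rcases hirr.eq_bot_or_eq_top f.ker with hbot | htop
  · -- `f` injective: impossible
    exfalso
    have hinj : Function.Injective f.toLinearMap := by
      rw [← LinearMap.ker_eq_bot, ← Hom.ker_toSubmodule]
      exact hbot
    obtain ⟨x, hx, hx0⟩ := Submodule.exists_mem_ne_zero_of_ne_bot h20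
    have h1 : f.toLinearMap.baseChange ℂ x ∈ (H.quotient T).piece 2 0 := f.map_piece_le 2 0 ⟨x, hx, rfl⟩
    rw [mem_quotient_piece_iff] at h1
    obtain ⟨y, hy, hyx⟩ := h1
    obtain ⟨u, hu⟩ : y ∈ T.toSubmodule.baseChange ℂ := htr.1 hy
    have hzero : T.toSubmodule.mkQ.baseChange ℂ y = 0 := by
      rw [← hu]
      clear hu
      induction u using TensorProduct.induction_on with
      | zero => rw [map_zero, map_zero]
      | tmul c s =>
        rw [LinearMap.baseChange_tmul, Submodule.subtype_apply, LinearMap.baseChange_tmul, Submodule.mkQ_apply,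
          (Submodule.Quotient.mk_eq_zero _).2 s.2, TensorProduct.tmul_zero]
      | add u₁ u₂ h₁ h₂ => rw [map_add, map_add, h₁, h₂, add_zero]
    apply hx0
    apply Hom.baseChange_injective f hinj
    rw [← hyx, hzero, map_zero]
  · have hk : (⟨t, ht⟩ : T.toSubmodule) ∈ f.ker.toSubmodule := by rw [htop]; exact Submodule.mem_top
    rw [Hom.ker_toSubmodule, LinearMap.mem_ker, hft] at hk
    exact (Submodule.Quotient.mk_eq_zero _).1 hk

/-- `T^{2,0} ≠ 0` for a Hodge structure of K3 type (`h^{2,0} = 1`). [cite: Huybrechts2016K3, Ch. 3 Def. 2.3] -/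
theorem piece_two_zero_ne_bot_of_isOfK3Type {V : Type*} [AddCommGroup V] [Module ℚ V] {H : HodgeStructure V 2}
    (hK3 : H.IsOfK3Type) : H.piece 2 0 ≠ ⊥ := by
  intro h
  have h1 := hK3.1
  rw [hodgeNumber, h, finrank_bot] at h1
  exact zero_ne_one h1

/-! ### §2 The marked fourfold: `q`-transcendence of the period, the presentation in `q`-form, conjugation -/

/-- **A `(2,0)`-class is `q`-orthogonal to `N¹(X)`**: algebraic divisor classes have type `(1,1)`, i.e. are
`q`-orthogonal to the period `z` (clause (m5)), and the `(2,0)`-classes are the multiples of `φ⁻¹ z` ((m4)).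
[cite: Beauville1983, §8] [cite: VoisinHodgeI2002, §7.1.2] -/
theorem bbfTransc_of_twoZero (hX : IsSmoothProjective (2 * 2) X) (hM : MarkedK3Sq[X, φ, P, z])
    {σ : complexBetti X 2} (hσ : IsOfHodgeType 4 X 2 2 0 σ) :
    ∀ e : complexBetti X 2, e ∈ algebraicClasses X 1 → k3HilbertForm 2 (φ σ) (φ e) = 0 := by
  obtain ⟨-, -, -, ⟨-, hspan⟩, h11, -⟩ := id hM
  intro e he
  obtain ⟨t, rfl⟩ := hspan σ hσ
  have he11 : IsOfHodgeType 4 X 2 1 1 e := isOfHodgeType_of_mem_algebraicClasses_of_isSmoothProjective hX 1 he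
  rw [map_smul, LinearEquiv.apply_symm_apply, k3HilbertForm_smul_left, k3HilbertForm_comm 2 z, ((h11 e).1 he11).1,
    mul_zero]

/-- **The presentation's image clause in `q`-form**: if `(T, −q_B|_T, T ↪ H²_B(X))` presents the transcendental
part for the Fujiki form `b = −q ∘ (φ × φ)` (`IsTranscendentalPartHK`), then `x ∈ T` iff `x ⊗ 1` is
`q`-orthogonal to every rational Hodge class. [cite: Floccari2024, §5.1] [cite: Huybrechts2016K3, Ch. 3 Lemma 3.1] -/
theorem mem_toSubmodule_iff_of_isTranscendentalPartHK (hX : IsSmoothProjective (2 * 2) X)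
    {b : complexBetti X 2 →ₗ[ℂ] complexBetti X 2 →ₗ[ℂ] ℂ} (hbq : ∀ x y, b x y = -k3HilbertForm 2 (φ x) (φ y))
    {T : SubHodgeStructure (H²_B[hX])} {Pol : T.toHodgeStructure.Polarization}
    (hj : IsTranscendentalPartHK hX _ _ b T.toHodgeStructure Pol T.subtypeHom) (x : bettiCohomology X (2 * 1)) :
    x ∈ T.toSubmodule ↔
      ∀ h ∈ (H²_B[hX]).hodgeClasses 1, k3HilbertForm 2 (φ (ι[X] x)) (φ (ι[X] h)) = 0 := by
  have h := hj.2.1 x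
  rw [SubHodgeStructure.subtypeHom_toLinearMap, Submodule.range_subtype] at h
  rw [h, bettiTwoHodgeStructureOfModel, cast_hodgeClasses]
  refine forall₂_congr fun k _ => ?_
  rw [hbq, neg_eq_zero]

/-- **`{y | y ⊥_q N¹(X)} = Θ(T_ℚ ⊗ ℂ)`**: a class `q`-orthogonal to the algebraic divisor classes is the
complexification of a vector of `ℂ ⊗ T` (`T = Hdg¹^{⊥ q_B}` for the rational Beauville–Bogomolov form `q_B`,
`(Hdg¹^⊥)_ℂ = (Hdg¹_ℂ)^⊥` by `baseChange_orthogonal_eq`, and `Θ(Hdg¹_ℂ) = N¹(X)`). [cite: Huybrechts2016K3, Ch. 3 Lemma 3.1] -/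
theorem exists_baseChange_eq_of_bbfTransc (hX : IsSmoothProjective (2 * 2) X) (hM : MarkedK3Sq[X, φ, P, z])
    (T : SubHodgeStructure (H²_B[hX]))
    (hT : ∀ x : bettiCohomology X (2 * 1), x ∈ T.toSubmodule ↔
      ∀ h ∈ (H²_B[hX]).hodgeClasses 1, k3HilbertForm 2 (φ (ι[X] x)) (φ (ι[X] h)) = 0)
    {y : complexBetti X 2} (hy : ∀ e : complexBetti X 2, e ∈ algebraicClasses X 1 → k3HilbertForm 2 (φ y) (φ e) = 0) :
    ∃ x : ℂ ⊗[ℚ] T.toSubmodule, Θ[X] (T.toSubmodule.subtype.baseChange ℂ x) = y := by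
  classical
  haveI : Module.Finite ℚ (bettiCohomology X (2 * 1)) := BettiUniverse.finite hX (2 * 1)
  obtain ⟨-, hint, -⟩ := id hM
  obtain ⟨qB, hsymm, hnd, hqB⟩ := exists_ratBBF hX hint
  -- `T = Hdg¹^{⊥ q_B}`
  have hTq : T.toSubmodule = qB.orthogonal ((H²_B[hX]).hodgeClasses 1) := by
    ext x
    rw [hT, LinearMap.BilinForm.mem_orthogonal_iff]
    refine forall₂_congr fun h _ => ?_
    change _ ↔ qB h x = 0
    rw [← Rat.cast_eq_zero (α := ℂ), hqB, k3HilbertForm_comm 2 (φ (ι[X] h))]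
  obtain ⟨w, rfl⟩ := ofRatClassBaseChange_surjective hX (2 * 1) y
  have hw : w ∈ (qB.orthogonal ((H²_B[hX]).hodgeClasses 1)).baseChange ℂ := by
    rw [baseChange_orthogonal_eq _ hnd, LinearMap.BilinForm.mem_orthogonal_iff]
    intro v hv
    have hΘv : Θ[X] v ∈ algebraicClasses X 1 := by
      rw [← map_hodgeClassesHK_baseChange_eq hX]
      exact ⟨v, hv, rfl⟩
    change (qB.baseChange ℂ) v w = 0
    rw [ratBBF_baseChange hqB, k3HilbertForm_comm 2 _ (φ (Θ[X] w))]
    exact hy _ hΘv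
  rw [← hTq] at hw
  obtain ⟨x, hx⟩ := hw
  exact ⟨x, congrArg (Θ[X]) hx⟩

/-- The complexification of a rational `θ` commutes with complex conjugation: `θ(ȳ) = \overline{θ(y)}`.
[cite: VoisinHodgeI2002, §7.1.1] -/
theorem apply_conjClassHK (hX : IsSmoothProjective (2 * 2) X) {θ : complexBetti X 2 →ₗ[ℂ] complexBetti X 2}
    {Ψ : bettiCohomology X (2 * 1) →ₗ[ℚ] bettiCohomology X (2 * 1)} (hΨ : ∀ v, ι[X] (Ψ v) = θ (ι[X] v))
    (y : complexBetti X 2) : θ (conjClass _ (2 * 1) y) = conjClass _ (2 * 1) (θ y) := by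
  obtain ⟨w, rfl⟩ := ofRatClassBaseChange_surjective hX (2 * 1) y
  rw [← ofRatClassBaseChange_conj_eq₄ hX w, ← ofRatClassBaseChange_baseChange_eq (S := X) hΨ (HodgeStructure.conj w),
    ← ofRatClassBaseChange_baseChange_eq (S := X) hΨ w, ← ofRatClassBaseChange_conj_eq₄ hX (Ψ.baseChange ℂ w),
    conj_baseChange]

/-- The image of a `(2,0)`-class of the fourfold under an algebraic correspondence of degree `0` on `H²` has type
`(2,0)` (`[γ]_*` for an algebraic, hence type-`(e,e)`, class `γ`). [cite: VoisinHodgeI2002, §11.3.3 Lemma 11.41] -/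
theorem isOfHodgeType_two_zero_of_isAlgebraicCorrespondenceHK {Y : SchemeOver ℂ} {m : ℕ}
    (hY : IsSmoothProjective m Y) (hX : IsSmoothProjective 4 X) {O : complexBetti X (2 * 1) →ₗ[ℂ] complexBetti Y 2}
    (hO : IsAlgebraicCorrespondence m 4 Y X O) {σ : complexBetti X (2 * 1)} (hσ : IsOfHodgeType 4 X (2 * 1) 2 0 σ) :
    IsOfHodgeType m Y 2 2 0 (O σ) := by
  obtain ⟨e, hab, γ, hγ, rfl⟩ := IsAlgebraicCorrespondence.exists_eq_corrAction hY hX hO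
  have hγt : IsOfHodgeType (m + 4) (Y ⊗ X) (2 * e) e e γ :=
    isOfHodgeType_of_mem_algebraicClasses_of_isSmoothProjective (hY.tensor_holds hX) e hγ
  exact Arapura2006.isOfHodgeType_corrAction_complex hY hX hab hγt (by omega) (by omega) hσ

/-! ### §3 Rational algebraic self-correspondences descend to `End_Hdg(T(X)_ℚ)` -/

/-- **A RATIONAL algebraic self-correspondence `[γ]_*` of the fourfold (degree `0` on `H²`) descends to a Hodge
endomorphism of the transcendental part**: for a rational algebraic `γ` there is `a ∈ End_Hdg(T)` with
`[γ]_*(t ⊗ 1) = a(t) ⊗ 1` for `t ∈ T` (`[γ]_*` is rational and type-preserving, `exists_hom_ofRatClass_eqHK`, and its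
descent preserves `T`, §1). [cite: VoisinHodgeI2002, §7.3.1 and Lemma 11.41] [cite: Huybrechts2016K3, Ch. 3 §3.3] -/
theorem exists_endAlg_of_isRationalClassHK (hX : IsSmoothProjective (2 * 2) X) (T : SubHodgeStructure (H²_B[hX]))
    (htr : (H²_B[hX]).IsTranscendentalPart T) (hirr : T.toHodgeStructure.IsIrreducible)
    (hK3T : T.toHodgeStructure.IsOfK3Type) {e : ℕ} (hab : 2 * 1 + 2 * e = 2 * 1 + 2 * 4)
    {γ : complexBetti (X ⊗ X) (2 * e)} (hγ : γ ∈ algebraicClasses (X ⊗ X) e) (hγQ : IsRationalClass γ) :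
    ∃ a : Module.End ℚ T.toSubmodule, a ∈ T.toHodgeStructure.endAlg ∧
      ∀ t : T.toSubmodule, corrAction complexOrientationFamily hX hX hab γ (ι[X] (t : bettiCohomology X (2 * 1))) =
        ι[X] ((a t : T.toSubmodule) : bettiCohomology X (2 * 1)) := by
  set f := corrAction complexOrientationFamily hX hX hab γ with hf
  have hγt : IsOfHodgeType (2 * 2 + 2 * 2) (X ⊗ X) (2 * e) e e γ :=
    isOfHodgeType_of_mem_algebraicClasses_of_isSmoothProjective (hX.tensor_holds hX) e hγ
  have h1 : ∀ y, IsRationalClass y → IsRationalClass (f y) :=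
    fun y hy => Arapura2006.isRationalClass_corrAction_complex hX hX hab hγQ hy
  have h2 : ∀ (i j : ℕ) y, IsOfHodgeType 4 X 2 i j y → IsOfHodgeType 4 X 2 i j (f y) :=
    fun i j y hy => Arapura2006.isOfHodgeType_corrAction_complex hX hX hab hγt (by omega) (by omega) hy
  obtain ⟨Ψ, hΨ⟩ := exists_hom_ofRatClass_eqHK hX f h1 h2
  have hmem : ∀ t : T.toSubmodule, (Ψ.comp T.subtypeHom).toLinearMap t ∈ T.toSubmodule := fun t =>
    apply_mem_of_isTranscendentalPart_of_irreducible htr hirr (piece_two_zero_ne_bot_of_isOfK3Type hK3T) Ψ t.2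
  refine ⟨((Ψ.comp T.subtypeHom).codRestrict T hmem).toLinearMap,
    ((Ψ.comp T.subtypeHom).codRestrict T hmem).map_F_le, fun t => (hΨ _).symm⟩

/-! ### §4 The multiplier of a `q`-self-adjoint self-similitude is positive -/

/-- **The multiplier of a `q`-self-adjoint rational Hodge self-similitude of `T(X)` is positive.** If `θ` is
rational, type-preserving and `q`-self-adjoint with `θ(θ σ) = d σ` for the period class `σ = φ⁻¹ z`, `d ≠ 0`,
then `0 < d`: `θσ = λσ`, `λ q(z, z̄) = q(θσ, σ̄) = q(σ, θσ̄) = λ̄ q(z, z̄)` with `q(z, z̄) > 0` ((m6)) forces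
`λ ∈ ℝ`, and `d = λ²`. [cite: Huybrechts2016K3, Ch. 3 Cor. 3.3.6] [cite: Beauville1983, §8 Thm. 5] -/
theorem multiplier_posHK (hX : IsSmoothProjective (2 * 2) X) (hM : MarkedK3Sq[X, φ, P, z])
    (θ : complexBetti X 2 →ₗ[ℂ] complexBetti X 2) (h1 : ∀ y, IsRationalClass y → IsRationalClass (θ y))
    (h2 : ∀ (i j : ℕ) y, IsOfHodgeType 4 X 2 i j y → IsOfHodgeType 4 X 2 i j (θ y))
    (h5 : ∀ y w : complexBetti X 2, k3HilbertForm 2 (φ (θ y)) (φ w) = k3HilbertForm 2 (φ y) (φ (θ w)))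
    {d : ℚ} (hd : d ≠ 0) (hθθσ : θ (θ (φ.symm z)) = (d : ℂ) • φ.symm z) : 0 < d := by
  obtain ⟨-, hint, -, ⟨h20, hspan⟩, -, -, hzpos⟩ := id hM
  obtain ⟨Ψ, hΨ⟩ := exists_ratLinear_ofRatClass_eq (S := X) θ h1
  obtain ⟨lam, hlam⟩ := hspan _ (h2 2 0 _ h20)
  obtain ⟨hr, hrpos⟩ := bbf_period_conj_eq_ofReal (z := z) hzpos
  set r : ℝ := (k3HilbertForm 2 (star z) z).re with hrdef
  have hr0 : (r : ℂ) ≠ 0 := by exact_mod_cast hrpos.ne'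
  have hσ0 : φ.symm z ≠ 0 := by
    intro h0
    have hz : z = 0 := by rw [← φ.apply_symm_apply z, h0, map_zero]
    rw [hrdef, hz, bbf_zero_right, Complex.zero_re] at hrpos
    exact lt_irrefl _ hrpos
  -- `θ σ̄ = λ̄ σ̄`
  have hconj : θ (conjClass _ (2 * 1) (φ.symm z)) = starRingEnd ℂ lam • conjClass _ (2 * 1) (φ.symm z) := by
    rw [apply_conjClassHK hX hΨ, hlam, conjClass_smul]
  -- `λ r = λ̄ r`
  have hreal : lam = starRingEnd ℂ lam := by
    have h := h5 (φ.symm z) (conjClass _ (2 * 1) (φ.symm z))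
    rw [hlam, hconj, map_smul, map_smul, marking_conjClass hint, LinearEquiv.apply_symm_apply,
      k3HilbertForm_smul_left, k3HilbertForm_comm 2 z (starRingEnd ℂ lam • star z), k3HilbertForm_smul_left,
      k3HilbertForm_comm 2 (star z) z, hr] at h
    exact mul_right_cancel₀ hr0 h
  -- `d = λ²`
  have hd2 : (d : ℂ) = lam * lam := by
    have h := hθθσ
    rw [hlam, map_smul, hlam, smul_smul] at h
    exact (smul_left_injective ℂ hσ0 h).symm
  have him : lam.im = 0 := Complex.conj_eq_iff_im.1 hreal.symm
  have hdre : (d : ℝ) = lam.re * lam.re := by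
    have h := congrArg Complex.re hd2
    rw [Complex.mul_re, him, mul_zero, sub_zero] at h
    exact_mod_cast h
  have hre0 : lam.re ≠ 0 := by
    intro h0
    apply hd
    have : (d : ℝ) = 0 := by rw [hdre, h0, mul_zero]
    exact_mod_cast this
  have hd' : (0 : ℝ) < d := by
    rw [hdre]
    exact mul_self_pos.2 hre0
  exact_mod_cast hd'

end Summit.HodgeConjecture.HodgeConjecture.Theorems.MarkmanPartnerTransport.KugaSatakeHK

end
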